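import Summits.HodgeConjecture.CorCM.MultiFieldWeilCommutantCriterion
import Summits.HodgeConjecture.CorCM.MultiFieldWeilUnitsRankedSeparated
import HarnessLib

/-!
# MULTI-FIELD WEIL ENGINE — THE COMMUTANT CRITERION, REALISED: the separation property of a unit from commutant-independence over the image of the realised tuples, and the
# frame headlines whose per-field hypothesis IS commutant-independence (the final form of the units method's per-field input)

Cell `pub-hodgecm2` (COR-CM), seat b30 gen 43 (2026-08-26); count-neutral own lane MULTI-FIELD WEIL ENGINE (stem `MultiFieldWeil*`), the realised ∕ geometric dress of
`CorCM/MultiFieldWeilCommutantCriterion.lean` (F1: over every transitive closed image, separated ⟺ commutant-independent) through the engines with ABSTRACT per-unit separation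
(`CorCM/MultiFieldWeilUnitsSeparated.lean` E4, `CorCM/MultiFieldWeilUnitsRankedSeparated.lean` E13).  Theorems only; no definition, no named fact, no `sorry`.  HONEST FRAMING:
the headlines conclude the Hodge conjecture for products of copies GIVEN the single-slot Weil spaces `hW`; `HC_CM` is NOT asserted.

* §1 (census ∕ realised) **`unit_separated_of_commutantIndependent`**, **`unit_separated_of_kernelBasis`**: E13's `unit_separated_of_twoTransitive` with `2`-transitivity +
  `ℚ`-independence REPLACED by F1's hypotheses read through the image of the tuple set `R` at the slot `m` — commutant-independence of the centred indicators of the unit's position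
  sets (every family of `R`-invariant integer kernels with zero row ∕ column sums and `Σ_i G_i c_i = 0` vanishes), or a kernel basis `A_t` with the vectors `A_t c_i` independent over
  `ℚ`; `R` closed under products and inverses and transitive on the slot (the realised tuples are: `mul_mem_realisedTuples`, `inv_mem_realisedTuples`, `transitive_realisedTuples`).
* §2 (frame headlines) **`hodgeConjectureFor_biproduct_comp_of_commutantIndependent_frames`** (+ dominated) and the ranked
  **`hodgeConjectureFor_biproduct_comp_of_commutantIndependentRanked_frames`**: E4's ∕ E13's frame headlines with the per-unit input `hunit` replaced by COMMUTANT-INDEPENDENCE over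
  the realised tuples.  READING: `k` imaginary quadratic, `E ⊨ (k; {τ})`, slots `B_m ⊨ (K_m; Φ_m)` over CM fields `K_m ⊇ k` read by sign frames; for every field carrying two or
  more structures, the `τ`-parts of its types are commutant-independent under the permutations of its `τ`-embeddings induced by `Aut(ℂ/k)`; single structures prime ∕ one-member ∕
  homogeneous; the cross-field hypotheses of E4 (realised tuples trivial on a unit transitive elsewhere) or of E13 (ranked: movers downwards, decoupling below `2`-transitive
  units) ⟹ the Hodge conjecture for EVERY product of copies, given the single-slot Weil spaces.  By F1 this per-field input is NECESSARY AND SUFFICIENT for the method: every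
  image-specific menu of the lane (`2`-transitive: gens 39–41; dihedral decic: gen 42) is the instance obtained by computing the commutant of the image.
[cite: Serre1977, §2.3 Ex. 2.6; §13.1] [cite: DixonMortimer1996, §1.4 Ex. 1.4.1–1.4.2; §2.1; §3.2] [cite: Lang2002, XIII §4; XVII §1] [cite: Pohlmann1968, Thm 1]
[cite: MoonenZarhin1995Duke, Thm. 2.4] [cite: Shimura1998, §18.2 Lemma (i)] [cite: Milne2020HodgeClassesAV, 1.2 (a) and Thm. 1]

## References
* [Serre1977] J.-P. Serre, *Linear Representations of Finite Groups*, GTM 42, §2.3 Ex. 2.6, §13.1.  [DixonMortimer1996] J. D. Dixon, B. Mortimer, *Permutation Groups*, GTM 163,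
  §1.4, §2.1, §3.2.  [Lang2002] S. Lang, *Algebra*, GTM 211, XIII §4, XVII §1.  [Pohlmann1968] H. Pohlmann, Ann. of Math. 88 (1968), Thm 1.  [MoonenZarhin1995Duke] B. Moonen,
  Yu. Zarhin, Duke Math. J. 77 (1995), Thm. 2.4.  [Shimura1998] G. Shimura, *Abelian varieties with complex multiplication and modular functions*, §18.2.
  [Milne2020HodgeClassesAV] J. S. Milne, arXiv:2010.08857, 1.2 (a), Thm. 1.
-/

noncomputable section

open CategoryTheory CategoryTheory.Limits NumberField

namespace Summit.HodgeConjecture.CorCM.MultiFieldWeil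

open Finset
open Literature.AlgebraicGeometry Literature.AlgebraicGeometry.Motives Literature.AlgebraicGeometry.HodgeTheory
open Literature.AlgebraicGeometry.ComplexMultiplication (IsCMTypeRealisation)
open Literature.AlgebraicTopology.SingularHomology
open Literature.NumberTheory.ComplexMultiplication
open Summit.HodgeConjecture.CorCM.Census.MultiFieldWeil

open scoped Classical

/-! ## §1 The separation property of a unit from commutant-independence over the image (census) -/

section Census

variable {r : ℕ} {n : Fin r → ℕ} {R : Finset (PermsG n)} {P : ∀ m : Fin r, Finset (Fin (n m))}

/-- **COMMUTANT-INDEPENDENCE OVER THE IMAGE ⟹ THE SEPARATION PROPERTY OF THE UNIT** (F1's `const_of_signed_of_commutantIndependent` read through the image of `R` at the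
slot `m`): `R` closed under products and inverses and transitive on the slot `m`; if every family of integer kernels on the letters of the slot, invariant under the image of `R`,
with zero row and column sums and `Σ_i G_i c_i = 0` (`c_i` the centred indicators of the unit's position sets read in the slot) vanishes, then every solution of the unit's signed
equations over `R` is constant — the hypothesis `hunit` of E4 ∕ E13. [cite: Serre1977, §2.3 Ex. 2.6; §13.1] [cite: DixonMortimer1996, §3.2] [cite: Lang2002, XVII §1] -/
theorem unit_separated_of_commutantIndependent (hmul : ∀ π ∈ R, ∀ π' ∈ R, π * π' ∈ R) (hinv : ∀ π ∈ R, π⁻¹ ∈ R)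
    (U : Fin r → Fin r) (hn : ∀ m m' : Fin r, U m' = U m → n m' = n m) (m : Fin r)
    (htrans : ∀ a b : Fin (n m), ∃ π ∈ R, π m a = b)
    (hind : ∀ G : {m' : Fin r // U m' = U m} → Fin (n m) → Fin (n m) → ℤ,
      (∀ π ∈ R, ∀ i a b, G i (π m a) (π m b) = G i a b) → (∀ i a, ∑ b, G i a b = 0) → (∀ i b, ∑ a, G i a b = 0) →
      (∀ a, ∑ i, ∑ b, G i a b * ((n m : ℤ) * (if b ∈ (P i.1).image (Fin.cast (hn m i.1 i.2)) then 1 else 0) - (P i.1).card) = 0) →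
      ∀ i a b, G i a b = 0)
    (u : {m' : Fin r // U m' = U m} → Fin (n m) → ℤ) (w : ℤ)
    (h : ∀ π ∈ R, (∑ i, ∑ x : Fin (n m), (if π m x ∈ (P i.1).image (Fin.cast (hn m i.1 i.2)) then u i x else -u i x)) = w)
    (i : {m' : Fin r // U m' = U m}) (a b : Fin (n m)) : u i a = u i b := by
  let H : Finset (Equiv.Perm (Fin (n m))) := R.image fun π => π m
  have hH : ∀ σ, σ ∈ H ↔ ∃ π ∈ R, π m = σ := fun σ => Finset.mem_image
  have hmulH : ∀ σ ∈ H, ∀ σ' ∈ H, σ * σ' ∈ H := by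
    intro σ hσ σ' hσ'
    obtain ⟨π, hπ, rfl⟩ := (hH σ).1 hσ
    obtain ⟨π', hπ', rfl⟩ := (hH σ').1 hσ'
    exact (hH _).2 ⟨π * π', hmul _ hπ _ hπ', rfl⟩
  have hinvH : ∀ σ ∈ H, σ⁻¹ ∈ H := by
    intro σ hσ
    obtain ⟨π, hπ, rfl⟩ := (hH σ).1 hσ
    exact (hH _).2 ⟨π⁻¹, hinv π hπ, rfl⟩
  have htransH : ∀ a b : Fin (n m), ∃ σ ∈ H, σ a = b := fun a b => by
    obtain ⟨π, hπ, hab⟩ := htrans a b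
    exact ⟨π m, (hH _).2 ⟨π, hπ, rfl⟩, hab⟩
  have hw : ∀ σ ∈ H, (∑ i, ∑ x : Fin (n m), (if σ x ∈ (P i.1).image (Fin.cast (hn m i.1 i.2)) then u i x else -u i x)) = w := by
    intro σ hσ
    obtain ⟨π, hπ, rfl⟩ := (hH σ).1 hσ
    exact h π hπ
  refine const_of_signed_of_commutantIndependent hmulH hinvH htransH
    (fun i : {m' : Fin r // U m' = U m} => (P i.1).image (Fin.cast (hn m i.1 i.2))) (fun G hG hrow hcol hrel => ?_) u hw i a b
  refine hind G (fun π hπ i a b => hG (π m) ((hH _).2 ⟨π, hπ, rfl⟩) i a b) hrow hcol fun a => ?_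
  have ha := hrel a
  rw [Finset.sum_congr rfl fun i _ => Finset.sum_congr rfl fun b _ => by rw [Finset.card_image_of_injective _ (Fin.cast_injective _)]] at ha
  exact ha

/-- **A KERNEL BASIS OVER THE IMAGE ⟹ THE SEPARATION PROPERTY OF THE UNIT** (F1's `const_of_signed_of_kernelBasis` read through the image of `R` at the slot `m`): every kernel
invariant under the image of `R` is `g₀ J + Σ_t g_t A_t`, and the vectors `A_t c_i` are independent over `ℚ`. [cite: DixonMortimer1996, §3.2] [cite: Lang2002, XIII §4] -/
theorem unit_separated_of_kernelBasis {s : ℕ} (hmul : ∀ π ∈ R, ∀ π' ∈ R, π * π' ∈ R) (hinv : ∀ π ∈ R, π⁻¹ ∈ R)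
    (U : Fin r → Fin r) (hn : ∀ m m' : Fin r, U m' = U m → n m' = n m) (m : Fin r)
    (htrans : ∀ a b : Fin (n m), ∃ π ∈ R, π m a = b) (A : Fin s → Fin (n m) → Fin (n m) → ℤ)
    (hspan : ∀ G : Fin (n m) → Fin (n m) → ℤ, (∀ π ∈ R, ∀ a b, G (π m a) (π m b) = G a b) → ∃ g₀ : ℤ, ∃ g : Fin s → ℤ, ∀ a b, G a b = g₀ + ∑ t, g t * A t a b)
    (hli : LinearIndependent ℚ fun p : {m' : Fin r // U m' = U m} × Fin s => fun a : Fin (n m) =>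
      ∑ b, (A p.2 a b : ℚ) * ((n m : ℚ) * (if b ∈ (P p.1.1).image (Fin.cast (hn m p.1.1 p.1.2)) then 1 else 0) - (P p.1.1).card))
    (u : {m' : Fin r // U m' = U m} → Fin (n m) → ℤ) (w : ℤ)
    (h : ∀ π ∈ R, (∑ i, ∑ x : Fin (n m), (if π m x ∈ (P i.1).image (Fin.cast (hn m i.1 i.2)) then u i x else -u i x)) = w)
    (i : {m' : Fin r // U m' = U m}) (a b : Fin (n m)) : u i a = u i b := by
  let H : Finset (Equiv.Perm (Fin (n m))) := R.image fun π => π m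
  have hH : ∀ σ, σ ∈ H ↔ ∃ π ∈ R, π m = σ := fun σ => Finset.mem_image
  have hmulH : ∀ σ ∈ H, ∀ σ' ∈ H, σ * σ' ∈ H := by
    intro σ hσ σ' hσ'
    obtain ⟨π, hπ, rfl⟩ := (hH σ).1 hσ
    obtain ⟨π', hπ', rfl⟩ := (hH σ').1 hσ'
    exact (hH _).2 ⟨π * π', hmul _ hπ _ hπ', rfl⟩
  have hinvH : ∀ σ ∈ H, σ⁻¹ ∈ H := by
    intro σ hσ
    obtain ⟨π, hπ, rfl⟩ := (hH σ).1 hσ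
    exact (hH _).2 ⟨π⁻¹, hinv π hπ, rfl⟩
  have htransH : ∀ a b : Fin (n m), ∃ σ ∈ H, σ a = b := fun a b => by
    obtain ⟨π, hπ, hab⟩ := htrans a b
    exact ⟨π m, (hH _).2 ⟨π, hπ, rfl⟩, hab⟩
  have hw : ∀ σ ∈ H, (∑ i, ∑ x : Fin (n m), (if σ x ∈ (P i.1).image (Fin.cast (hn m i.1 i.2)) then u i x else -u i x)) = w := by
    intro σ hσ
    obtain ⟨π, hπ, rfl⟩ := (hH σ).1 hσ
    exact h π hπ
  have hli' : LinearIndependent ℚ fun p : {m' : Fin r // U m' = U m} × Fin s => fun a : Fin (n m) =>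
      ∑ b, (A p.2 a b : ℚ) * ((n m : ℚ) * (if b ∈ (P p.1.1).image (Fin.cast (hn m p.1.1 p.1.2)) then 1 else 0) -
        ((P p.1.1).image (Fin.cast (hn m p.1.1 p.1.2))).card) := by
    have hfun : (fun p : {m' : Fin r // U m' = U m} × Fin s => fun a : Fin (n m) =>
        ∑ b, (A p.2 a b : ℚ) * ((n m : ℚ) * (if b ∈ (P p.1.1).image (Fin.cast (hn m p.1.1 p.1.2)) then 1 else 0) -
          ((P p.1.1).image (Fin.cast (hn m p.1.1 p.1.2))).card)) =
        fun p : {m' : Fin r // U m' = U m} × Fin s => fun a : Fin (n m) =>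
          ∑ b, (A p.2 a b : ℚ) * ((n m : ℚ) * (if b ∈ (P p.1.1).image (Fin.cast (hn m p.1.1 p.1.2)) then 1 else 0) - (P p.1.1).card) := by
      funext p a
      rw [Finset.card_image_of_injective _ (Fin.cast_injective _)]
    rw [hfun]
    exact hli
  exact const_of_signed_of_kernelBasis hmulH hinvH htransH (fun i : {m' : Fin r // U m' = U m} => (P i.1).image (Fin.cast (hn m i.1 i.2))) A
    (fun G hG => hspan G fun π hπ a b => hG (π m) ((hH _).2 ⟨π, hπ, rfl⟩) a b) hli' u hw i a b

end Census

/-! ## §2 The frame headlines with commutant-independence as the per-field input -/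

section Headline

variable {I : Type} {r : ℕ} {Kf : I → Type} [∀ i, Field (Kf i)] [∀ i, NumberField (Kf i)] [∀ i, IsCMField (Kf i)]
  {i₀ : I} {is : Fin r → I} {n : Fin r → ℕ} {τ : Kf i₀ →+* ℂ}
  {A : Fin (r + 1) → AbelianVariety ℂ} {Φ : ∀ j : Fin (r + 1), CMType (Kf (mfSlots i₀ is j))}
  {ι : ∀ j, 𝓞 (Kf (mfSlots i₀ is j)) →+* End (A j)}
  {θ : ∀ j, Kf (mfSlots i₀ is j) →+* Module.End ℂ (complexBetti (A j).X 1)}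

/-- **HEADLINE (frame form) — COMMUTANT-INDEPENDENT UNITS, GIVEN THE SINGLE-SLOT WEIL SPACES.**  E4's `hodgeConjectureFor_biproduct_comp_of_unitsSeparated_frames` with the per-unit
separation property REPLACED by commutant-independence of the unit's centred indicators under the realised tuples (necessary and sufficient for it, F1): `k = Kf i₀` imaginary
quadratic, `E = A 0 ⊨ (k; {τ})` (`τ(δ) = i√d`), `B_m = A (m+1) ⊨ (K_m; Φ (m+1))`, `[K_m : k] = n_m`, types read by sign frames at position sets `P m` (`0 < p_m`, `2 p_m ≤ n_m`);
units = fibres of `U` (one size, realised tuples diagonal); the realised tuples trivial on a unit transitive on every slot outside it; single slots prime ∕ `p_m = 1` ∕ homogeneous.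
Then the Hodge conjecture holds for every product of copies `⨁_j A(κ j)`, GIVEN the single-slot Weil spaces `hW`.  `HC_CM` is NOT asserted. [cite: Serre1977, §2.3 Ex. 2.6; §13.1]
[cite: Pohlmann1968, Thm 1] [cite: MoonenZarhin1995Duke, Thm. 2.4] [cite: Shimura1998, §18.2 Lemma (i)] [cite: Milne2020HodgeClassesAV, 1.2 (a) and Thm. 1]
[cite: DixonMortimer1996, §1.4 Ex. 1.4.1–1.4.2; §2.1; §3.2] -/
theorem hodgeConjectureFor_biproduct_comp_of_commutantIndependent_frames (P : ∀ m : Fin r, Finset (Fin (n m))) (p : Fin r → ℕ)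
    (hcard : ∀ m, (P m).card = p m) (hp0 : ∀ m, 0 < p m) (hpn : ∀ m, 2 * p m ≤ n m)
    {N : ℕ} (κ : Fin N → Fin (r + 1)) (h2 : Module.finrank ℚ (Kf i₀) = 2) (im : ∀ m : Fin r, Kf i₀ →+* Kf (is m))
    {δ : 𝓞 (Kf i₀)} {d : ℕ} (hτ : τ (δ : Kf i₀) = Complex.I * (Real.sqrt d : ℂ))
    (hA : ∀ j, IsCMTypeRealisation (Φ j) (A j) (ι j) (θ j))
    (e : ∀ m : Fin r, (Kf (is m) →+* ℂ) ≃ Fin (n m) × Bool)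
    (he_sign : ∀ (m : Fin r) (s : Kf (is m) →+* ℂ), (e m s).2 = true ↔ s.comp (im m) = τ)
    (he_conj : ∀ (m : Fin r) (s : Kf (is m) →+* ℂ), e m (ComplexEmbedding.conjugate s) = ((e m s).1, !(e m s).2))
    (hΨ : ∀ σ : Kf i₀ →+* ℂ, σ ∈ (Φ 0).1 ↔ σ = τ)
    (hΦ : ∀ (m : Fin r) (s : Kf (is m) →+* ℂ), s ∈ (Φ m.succ).1 ↔ (e m s).2 = decide ((e m s).1 ∈ P m))
    (U : Fin r → Fin r) (hn : ∀ m m' : Fin r, U m' = U m → n m' = n m)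
    (hdiag : ∀ π ∈ realisedTuples e τ, ∀ (m m' : Fin r) (h : U m' = U m) (a : Fin (n m')), Fin.cast (hn m m' h) (π m' a) = π m (Fin.cast (hn m m' h) a))
    (hstab : ∀ (m₀ m : Fin r), U m₀ ≠ U m → ∀ a a' : Fin (n m), ∃ ν ∈ realisedTuples e τ, (∀ m', U m' = U m₀ → ν m' = 1) ∧ ν m a = a')
    (hind : ∀ m, (∃ m', m' ≠ m ∧ U m' = U m) → ∀ G : {m' : Fin r // U m' = U m} → Fin (n m) → Fin (n m) → ℤ,
      (∀ π ∈ realisedTuples e τ, ∀ i a b, G i (π m a) (π m b) = G i a b) → (∀ i a, ∑ b, G i a b = 0) → (∀ i b, ∑ a, G i a b = 0) →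
      (∀ a, ∑ i, ∑ b, G i a b * ((n m : ℤ) * (if b ∈ (P i.1).image (Fin.cast (hn m i.1 i.2)) then 1 else 0) - (P i.1).card) = 0) →
      ∀ i a b, G i a b = 0)
    (hkind : ∀ m : Fin r, (∀ m', U m' = U m → m' = m) → (n m).Prime ∨ p m = 1 ∨
      ∀ Q : Finset (Fin (n m)), Q.card = p m → ∃ π ∈ realisedTuples e τ, preG (π m) (P m) = Q)
    (hW : ∀ m : Fin r, weilClassesOf (⨁ fun i => A (partSlots (n m - 2 * p m) m i))
      (biproduct.map fun i => ι (partSlots (n m - 2 * p m) m i) (δfam im δ (partSlots (n m - 2 * p m) m i))) (n m - p m) d ≤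
      algebraicClasses (⨁ fun i => A (partSlots (n m - 2 * p m) m i)).X (n m - p m)) :
    HodgeConjectureFor (⨁ fun j => A (κ j)).dim (⨁ fun j => A (κ j)).X :=
  hodgeConjectureFor_biproduct_comp_of_unitsSeparated_frames P p hcard hp0 hpn κ h2 im hτ hA e he_sign he_conj hΨ hΦ U hn hdiag hstab
    (fun m hm u w h i a b => unit_separated_of_commutantIndependent (fun _ hπ _ hπ' => mul_mem_realisedTuples e τ hπ hπ')
      (fun _ hπ => inv_mem_realisedTuples hπ) U hn m (fun a b => transitive_realisedTuples (e := e) he_sign m a b) (hind m hm) u w h i a b)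
    hkind hW

/-- **Dominated form.** [cite: MumfordAV1970, §19 Thm. 1 and p. 169] [cite: Pohlmann1968, Thm 1] -/
theorem hodgeConjectureFor_of_avDominatedBy_comp_of_commutantIndependent_frames (P : ∀ m : Fin r, Finset (Fin (n m))) (p : Fin r → ℕ)
    (hcard : ∀ m, (P m).card = p m) (hp0 : ∀ m, 0 < p m) (hpn : ∀ m, 2 * p m ≤ n m)
    {N : ℕ} (κ : Fin N → Fin (r + 1)) (h2 : Module.finrank ℚ (Kf i₀) = 2) (im : ∀ m : Fin r, Kf i₀ →+* Kf (is m))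
    {δ : 𝓞 (Kf i₀)} {d : ℕ} (hτ : τ (δ : Kf i₀) = Complex.I * (Real.sqrt d : ℂ))
    (hA : ∀ j, IsCMTypeRealisation (Φ j) (A j) (ι j) (θ j))
    (e : ∀ m : Fin r, (Kf (is m) →+* ℂ) ≃ Fin (n m) × Bool)
    (he_sign : ∀ (m : Fin r) (s : Kf (is m) →+* ℂ), (e m s).2 = true ↔ s.comp (im m) = τ)
    (he_conj : ∀ (m : Fin r) (s : Kf (is m) →+* ℂ), e m (ComplexEmbedding.conjugate s) = ((e m s).1, !(e m s).2))
    (hΨ : ∀ σ : Kf i₀ →+* ℂ, σ ∈ (Φ 0).1 ↔ σ = τ)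
    (hΦ : ∀ (m : Fin r) (s : Kf (is m) →+* ℂ), s ∈ (Φ m.succ).1 ↔ (e m s).2 = decide ((e m s).1 ∈ P m))
    (U : Fin r → Fin r) (hn : ∀ m m' : Fin r, U m' = U m → n m' = n m)
    (hdiag : ∀ π ∈ realisedTuples e τ, ∀ (m m' : Fin r) (h : U m' = U m) (a : Fin (n m')), Fin.cast (hn m m' h) (π m' a) = π m (Fin.cast (hn m m' h) a))
    (hstab : ∀ (m₀ m : Fin r), U m₀ ≠ U m → ∀ a a' : Fin (n m), ∃ ν ∈ realisedTuples e τ, (∀ m', U m' = U m₀ → ν m' = 1) ∧ ν m a = a')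
    (hind : ∀ m, (∃ m', m' ≠ m ∧ U m' = U m) → ∀ G : {m' : Fin r // U m' = U m} → Fin (n m) → Fin (n m) → ℤ,
      (∀ π ∈ realisedTuples e τ, ∀ i a b, G i (π m a) (π m b) = G i a b) → (∀ i a, ∑ b, G i a b = 0) → (∀ i b, ∑ a, G i a b = 0) →
      (∀ a, ∑ i, ∑ b, G i a b * ((n m : ℤ) * (if b ∈ (P i.1).image (Fin.cast (hn m i.1 i.2)) then 1 else 0) - (P i.1).card) = 0) →
      ∀ i a b, G i a b = 0)
    (hkind : ∀ m : Fin r, (∀ m', U m' = U m → m' = m) → (n m).Prime ∨ p m = 1 ∨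
      ∀ Q : Finset (Fin (n m)), Q.card = p m → ∃ π ∈ realisedTuples e τ, preG (π m) (P m) = Q)
    (hW : ∀ m : Fin r, weilClassesOf (⨁ fun i => A (partSlots (n m - 2 * p m) m i))
      (biproduct.map fun i => ι (partSlots (n m - 2 * p m) m i) (δfam im δ (partSlots (n m - 2 * p m) m i))) (n m - p m) d ≤
      algebraicClasses (⨁ fun i => A (partSlots (n m - 2 * p m) m i)).X (n m - p m))
    {X : AbelianVariety ℂ} (hX : Domination.AVDominatedBy X (⨁ fun j => A (κ j))) : HodgeConjectureFor X.dim X.X :=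
  Domination.hodgeConjectureFor_of_avDominatedBy
    (hodgeConjectureFor_biproduct_comp_of_commutantIndependent_frames P p hcard hp0 hpn κ h2 im hτ hA e he_sign he_conj hΨ hΦ U hn hdiag hstab hind hkind hW) hX

/-- **HEADLINE (frame form) — RANKED COMMUTANT-INDEPENDENT UNITS, GIVEN THE SINGLE-SLOT WEIL SPACES.**  E13's `hodgeConjectureFor_biproduct_comp_of_unitsRankedSeparated_frames`
with the per-unit separation property REPLACED by commutant-independence over the realised tuples; the ranked cross-unit hypothesis `hpair` (movers downwards, decoupling below
`2`-transitive units with more letters) unchanged.  `HC_CM` is NOT asserted. [cite: Serre1977, §2.2 Cor. 2–3 of Prop. 4; §2.3 Ex. 2.6; §13.1] [cite: Pohlmann1968, Thm 1]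
[cite: MoonenZarhin1995Duke, Thm. 2.4] [cite: Milne2020HodgeClassesAV, 1.2 (a) and Thm. 1] [cite: DixonMortimer1996, §1.4 Ex. 1.4.1–1.4.2; §2.1; §3.2] [cite: Lang2002, XIII §4] -/
theorem hodgeConjectureFor_biproduct_comp_of_commutantIndependentRanked_frames (P : ∀ m : Fin r, Finset (Fin (n m))) (p : Fin r → ℕ)
    (hcard : ∀ m, (P m).card = p m) (hp0 : ∀ m, 0 < p m) (hpn : ∀ m, 2 * p m ≤ n m)
    {N : ℕ} (κ : Fin N → Fin (r + 1)) (h2 : Module.finrank ℚ (Kf i₀) = 2) (im : ∀ m : Fin r, Kf i₀ →+* Kf (is m))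
    {δ : 𝓞 (Kf i₀)} {d : ℕ} (hτ : τ (δ : Kf i₀) = Complex.I * (Real.sqrt d : ℂ))
    (hA : ∀ j, IsCMTypeRealisation (Φ j) (A j) (ι j) (θ j))
    (e : ∀ m : Fin r, (Kf (is m) →+* ℂ) ≃ Fin (n m) × Bool)
    (he_sign : ∀ (m : Fin r) (s : Kf (is m) →+* ℂ), (e m s).2 = true ↔ s.comp (im m) = τ)
    (he_conj : ∀ (m : Fin r) (s : Kf (is m) →+* ℂ), e m (ComplexEmbedding.conjugate s) = ((e m s).1, !(e m s).2))
    (hΨ : ∀ σ : Kf i₀ →+* ℂ, σ ∈ (Φ 0).1 ↔ σ = τ)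
    (hΦ : ∀ (m : Fin r) (s : Kf (is m) →+* ℂ), s ∈ (Φ m.succ).1 ↔ (e m s).2 = decide ((e m s).1 ∈ P m))
    (U : Fin r → Fin r) (hn : ∀ m m' : Fin r, U m' = U m → n m' = n m)
    (hdiag : ∀ π ∈ realisedTuples e τ, ∀ (m m' : Fin r) (h : U m' = U m) (a : Fin (n m')), Fin.cast (hn m m' h) (π m' a) = π m (Fin.cast (hn m m' h) a))
    (rk : Fin r → ℕ) (hrk : ∀ m m' : Fin r, U m' = U m → rk m' = rk m)
    (hpair : ∀ m₀ m : Fin r, U m ≠ U m₀ → rk m ≤ rk m₀ →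
      (∀ a a' : Fin (n m), ∃ ν ∈ realisedTuples e τ, (∀ m', U m' = U m₀ → ν m' = 1) ∧ ν m a = a') ∨
      (∀ m', U m' = U m₀ → (∀ a a' b b' : Fin (n m'), a ≠ a' → b ≠ b' → ∃ π ∈ realisedTuples e τ, π m' a = b ∧ π m' a' = b') ∧ n m < n m'))
    (hind : ∀ m, (∃ m', m' ≠ m ∧ U m' = U m) → ∀ G : {m' : Fin r // U m' = U m} → Fin (n m) → Fin (n m) → ℤ,
      (∀ π ∈ realisedTuples e τ, ∀ i a b, G i (π m a) (π m b) = G i a b) → (∀ i a, ∑ b, G i a b = 0) → (∀ i b, ∑ a, G i a b = 0) →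
      (∀ a, ∑ i, ∑ b, G i a b * ((n m : ℤ) * (if b ∈ (P i.1).image (Fin.cast (hn m i.1 i.2)) then 1 else 0) - (P i.1).card) = 0) →
      ∀ i a b, G i a b = 0)
    (hkind : ∀ m : Fin r, (∀ m', U m' = U m → m' = m) → (n m).Prime ∨ p m = 1 ∨
      ∀ Q : Finset (Fin (n m)), Q.card = p m → ∃ π ∈ realisedTuples e τ, preG (π m) (P m) = Q)
    (hW : ∀ m : Fin r, weilClassesOf (⨁ fun i => A (partSlots (n m - 2 * p m) m i))
      (biproduct.map fun i => ι (partSlots (n m - 2 * p m) m i) (δfam im δ (partSlots (n m - 2 * p m) m i))) (n m - p m) d ≤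
      algebraicClasses (⨁ fun i => A (partSlots (n m - 2 * p m) m i)).X (n m - p m)) :
    HodgeConjectureFor (⨁ fun j => A (κ j)).dim (⨁ fun j => A (κ j)).X :=
  hodgeConjectureFor_biproduct_comp_of_unitsRankedSeparated_frames P p hcard hp0 hpn κ h2 im hτ hA e he_sign he_conj hΨ hΦ U hn hdiag rk hrk hpair
    (fun m hm u w h i a b => unit_separated_of_commutantIndependent (fun _ hπ _ hπ' => mul_mem_realisedTuples e τ hπ hπ')
      (fun _ hπ => inv_mem_realisedTuples hπ) U hn m (fun a b => transitive_realisedTuples (e := e) he_sign m a b) (hind m hm) u w h i a b)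
    hkind hW

end Headline

end Summit.HodgeConjecture.CorCM.MultiFieldWeil

end
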